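import Summits.BirchSwinnertonDyer.BirchSwinnertonDyer.Theorems.Rank2Observatory2DescClFieldCertE
import Summits.BirchSwinnertonDyer.BirchSwinnertonDyer.Theorems.Rank2Observatory2DescClSplitPrimes
import HarnessLib

/-!
# BirchSwinnertonDyer — rank ≥ 2 observatory: KERNEL-2DESC-CL v3.0, S3 — THE SPLIT-2 FIELD CERTIFICATE (`ClFieldCertS`)

HONEST FRAMING: per-curve certified theorems and census instruments; no claim on BSD in rank ≥ 2.

Generic layer of the KERNEL-2DESC-CL instrument (design `…/v2/generics/v27/noeta/SPLIT2-SPEC.md` §4).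
The per-field certificate for a cubic field in which `2` is TOTALLY SPLIT and the census generator `α` has
index a power of `2` (no monogenic `2`-maximal order exists; the two-view record `ClFieldCertE` cannot be
instantiated): a v2.0 record `base` for the `α`-view (rows of the ODD primes — all of them non-index primes —,
the auxiliary prime `q`, the residue characters), the split certificate `split : SplitTwo` (`…ClSplitPrimes`) naming
the three primes above `2`, class certificates at those three primes (`ClassCertS`) and — for `α`-row codes whose
relation element lies outside `ℤ[α]` — FRACTIONAL class certificates `ClassCertA`, and a discriminant helper
`dh` (an integral generator `θ'` with its cubic `h`; the Minkowski inequality is run against `gcd(Δ(g), Δ(h))`,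
tree lemma `eq_top_of_classIn_lt_gcd`).  Main theorem `closure_q_eq_top_of_coreS`: the classes of the primes
above `q` generate the class group.  Every check is a `Bool` on integers.
Sorry-free; axioms `propext`, `Classical.choice`, `Quot.sound`.
[cite: Marcus2018, Ch. 5, Cor. 2 to Thm. 35] [cite: Cohen1993, §4.8.2, §6.5]
-/

set_option linter.dupNamespace false

noncomputable section

open scoped Classical NumberField nonZeroDivisors

open Literature.NumberTheory.NumberFields Polynomial Module NumberField IsDedekindDomain Ideal

namespace Summit.BirchSwinnertonDyer.BirchSwinnertonDyer.Rank2Observatory.TwoDescCl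

open TwoDescCubic

variable {K : Type*} [Field K] [NumberField K] {a b c : ℤ} {θ : K}

/-! ## Fractional class certificates for `α`-row codes -/

namespace FracElt

/-- WITNESS CHECK against an element of `ℤ[α]`: `x = p·s + G(α)·t` with `G` given by coordinates `g`
(`x, s, t` fractional). [folklore] -/
def linCheckZ (a b c : ℤ) (p : ℕ) (x : FracElt) (g : ℤ × ℤ × ℤ) (s t : FracElt) : Bool :=
  decide (zsmul ((s.m : ℤ) * t.m) x.X =
    zsmul ((p : ℤ) * x.m * t.m) s.X + zsmul ((x.m : ℤ) * s.m) (MonicCubic.mulCoords a b c g t.X))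

/-- Soundness of `linCheckZ` in `K`. [folklore] -/
theorem val_eq_of_linCheckZ (hθ : aeval θ (MonicCubic.poly a b c) = 0) {p : ℕ} {x s t : FracElt}
    {g : ℤ × ℤ × ℤ} (hx : 0 < x.m) (hs : 0 < s.m) (ht : 0 < t.m) (h : linCheckZ a b c p x g s t = true) :
    x.val θ = (p : K) * s.val θ + MonicCubic.evalCoords θ g * t.val θ := by
  simp only [linCheckZ, decide_eq_true_eq] at h
  have hK := congrArg (MonicCubic.evalCoords θ) h
  rw [MonicCubic.evalCoords_add, evalCoords_zsmul, evalCoords_zsmul, evalCoords_zsmul,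
    MonicCubic.evalCoords_mulCoords (MonicCubic.theta_rel hθ)] at hK
  have hx' : (x.m : K) ≠ 0 := Nat.cast_ne_zero.mpr hx.ne'
  have hs' : (s.m : K) ≠ 0 := Nat.cast_ne_zero.mpr hs.ne'
  have ht' : (t.m : K) ≠ 0 := Nat.cast_ne_zero.mpr ht.ne'
  simp only [val]
  simp only [MonicCubic.evalCoords] at hK ⊢
  field_simp
  push_cast at hK ⊢
  linear_combination hK

/-- Soundness of `linCheckZ` in `𝓞 K`. [folklore] -/
theorem toInt_eq_of_linCheckZ (hθ : aeval θ (MonicCubic.poly a b c) = 0) {p : ℕ} {x s t : FracElt}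
    {g : ℤ × ℤ × ℤ} (cx : x.check a b c = true) (cs : s.check a b c = true) (ct : t.check a b c = true)
    (h : linCheckZ a b c p x g s t = true) :
    x.toInt hθ cx = (p : 𝓞 K) * s.toInt hθ cs + lin hθ g.1 g.2.1 g.2.2 * t.toInt hθ ct := by
  apply IsFractionRing.injective (𝓞 K) K
  rw [map_add, map_mul, map_mul, algebraMap_toInt, algebraMap_toInt, algebraMap_toInt, map_natCast,
    algebraMap_lin]
  have h1 := val_eq_of_linCheckZ hθ (m_pos_of_check cx) (m_pos_of_check cs) (m_pos_of_check ct) h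
  simpa only [MonicCubic.evalCoords] using h1

/-- **Membership form**: `x ∈ (p, G(α))`. [folklore] -/
theorem mem_span_pair_of_linCheckZ (hθ : aeval θ (MonicCubic.poly a b c) = 0) {p : ℕ} {x s t : FracElt}
    {g : ℤ × ℤ × ℤ} (cx : x.check a b c = true) (cs : s.check a b c = true) (ct : t.check a b c = true)
    (h : linCheckZ a b c p x g s t = true) :
    x.toInt hθ cx ∈ Ideal.span {(p : 𝓞 K), lin hθ g.1 g.2.1 g.2.2} := by
  rw [toInt_eq_of_linCheckZ hθ cx cs ct h, Ideal.mem_span_pair]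
  exact ⟨s.toInt hθ cs, t.toInt hθ ct, by ring⟩

end FracElt

/-- FRACTIONAL CLASS CERTIFICATE of an `α`-row code `C = (p, G)` relative to `q`: `γ = p·s + G(α)·t` with
`|N(γ)| = p^{deg C} · q^j`. [cite: Cohen1993, §6.5 (relations)] -/
structure ClassCertA where
  C : PCode
  γ : FracElt
  s : FracElt
  t : FracElt
  j : ℕ

/-- Check of a fractional class certificate. [cite: Cohen1993, §6.5 (relations)] -/
def ClassCertA.check (a b c : ℤ) (q : ℕ) (ce : ClassCertA) : Bool :=
  ce.γ.check a b c && (ce.s.check a b c && (ce.t.check a b c &&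
    (FracElt.linCheckZ a b c ce.C.1 ce.γ ce.C.2 ce.s ce.t &&
      decide ((normFormZ a b c ce.γ.X.1 ce.γ.X.2.1 ce.γ.X.2.2).natAbs = ce.γ.m ^ 3 * (ce.C.1 ^ codeDeg ce.C * q ^ ce.j)))))

/-- **`[P_C] ∈ H_q`** from a fractional class certificate of the code `C` of a checked row.
[cite: Marcus2018, Ch. 5, Thm. 35] -/
theorem classIn_of_classCertA (hirr : Irreducible (MonicCubic.polyQ a b c))
    (hθ : aeval θ (MonicCubic.poly a b c) = 0) (h3 : finrank ℚ K = 3) {e : PrimeEntry} (hp : e.p.Prime)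
    (h : e.check a b c = true) {C : PCode} (hC : C ∈ e.codes) {q : ℕ} (hq : q.Prime) {ce : ClassCertA}
    (hce : ce.check a b c q = true) (hCe : ce.C = C) :
    ClassIn (Subgroup.closure {cc : ClassGroup (𝓞 K) | ∃ (J : Ideal (𝓞 K))
      (hJ : J ∈ (Ideal (𝓞 K))⁰), ((q : ℕ) : 𝓞 K) ∈ J ∧ ClassGroup.mk0 ⟨J, hJ⟩ = cc}) (idealOf hθ C) := by
  subst hCe
  have habs := absNorm_of_check hirr hθ h3 hp h hC
  have hP0 := (isPrime_and_ne_bot_of_check hirr hθ h3 hp h hC).2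
  have hfst := code_fst_of_mem hC
  simp only [ClassCertA.check, Bool.and_eq_true, decide_eq_true_eq] at hce
  obtain ⟨cγ, cs, ct, hlin, hN⟩ := hce
  have hmem := FracElt.mem_span_pair_of_linCheckZ hθ cγ cs ct hlin
  have hnorm := FracElt.natAbs_norm_toInt hirr hθ h3 ce.γ cγ hN
  refine classIn_tsupp_of_rel hq hP0 (β := ce.γ.toInt hθ cγ) hmem ce.j ?_
  rw [hnorm, habs, hfst]

/-! ## The record -/

/-- **Split-2 per-field certificate**: the `α`-view record `base` (rows of the odd primes, `q`, characters; its
archimedean and sweep clauses are NOT used), the split certificate naming the primes above `2`, class certificates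
at those primes and fractional class certificates for `α`-row codes, and a discriminant helper `θ' = dh` with its
cubic `h = X³ − T X² + S X − N` and an irreducibility modulus. Pure data. [cite: Cohen1993, §4.8.2, §6.5] -/
structure ClFieldCertS where
  /-- the `α`-view record (v2.0, file 3) -/
  base : ClFieldCert
  /-- the three primes above the totally split `2` -/
  split : SplitTwo
  /-- class certificates at `w₀, w₁, w₂` relative to `q` -/
  cls2 : Fin 3 → SplitTwo.ClassCertS
  /-- fractional class certificates for `α`-row codes (may be empty) -/
  clsA : List ClassCertA
  /-- discriminant helper: an integral generator `θ'` -/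
  dh : FracElt
  /-- a modulus modulo which the cubic of `θ'` has no root -/
  pIrrS : ℕ

namespace ClFieldCertS

variable (fs : ClFieldCertS)

/-- `h = X³ + a′X² + b′X + c′`, the cubic of `θ'`: `a′ = −T`. -/
def a' : ℤ := -fs.dh.T
/-- `b′ = S`. -/
def b' : ℤ := fs.dh.S
/-- `c′ = −N`. -/
def c' : ℤ := -fs.dh.N

/-- **Split sweep**: Minkowski inequality against `gcd(Δ(g), Δ(h))`, coverage of every prime `p < bM` by `q`, by `2`
(the split row) or by an `α`-row, class certificates of every `α`-row code in range (one-view `classCheck` or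
fractional `ClassCertA`) and at the three primes above `2`. Computable. [cite: Marcus2018, Ch. 5, Cor. 2 to Thm. 35] -/
def checkSweepS : Bool :=
  decide (64 * (Int.gcd (MonicCubic.disc fs.base.a fs.base.b fs.base.c) (MonicCubic.disc fs.a' fs.b' fs.c') : ℤ) <
      799 * (fs.base.bM : ℤ) ^ 2) &&
    (((List.range fs.base.bM).all fun n =>
      decide (n < 2) || ClFieldCert.smallFactor n || n == fs.base.q || n == 2 ||
        fs.base.primes.any fun e => e.p == n) &&
    ((fs.base.primes.all fun e => decide (fs.base.bM ≤ e.p) ||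
      e.codes.all fun C => (e.cls.any fun dd =>
        classCheck fs.base.a fs.base.b fs.base.c fs.base.q fs.base.bM C dd) ||
        fs.clsA.any fun ce => ce.C == C && ce.check fs.base.a fs.base.b fs.base.c fs.base.q) &&
    decide (∀ i : Fin 3, (fs.cls2 i).check fs.base.a fs.base.b fs.base.c fs.base.q (fs.split.pi i) = true)))

/-- **The signature-free split core**: registry core of `base`, the split certificate, the helper's integrality and
irreducibility, the split sweep. Computable; run once per field by `decide +kernel`. -/
def checkCoreS : Bool :=
  fs.base.checkReg && (fs.split.check fs.base.a fs.base.b fs.base.c && (fs.dh.check fs.base.a fs.base.b fs.base.c &&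
    (noRootMod fs.pIrrS fs.a' fs.b' fs.c' && fs.checkSweepS)))

/-! ## Soundness -/

/-- The registry core of `base` holds. -/
theorem checkReg_of_coreS (hS : fs.checkCoreS = true) : fs.base.checkReg = true := by
  simp only [checkCoreS, Bool.and_eq_true] at hS; exact hS.1

/-- The split certificate holds. -/
theorem splitCheck_of_coreS (hS : fs.checkCoreS = true) : fs.split.check fs.base.a fs.base.b fs.base.c = true := by
  simp only [checkCoreS, Bool.and_eq_true] at hS; exact hS.2.1

/-- The helper is integral. -/
theorem dhCheck_of_coreS (hS : fs.checkCoreS = true) : fs.dh.check fs.base.a fs.base.b fs.base.c = true := by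
  simp only [checkCoreS, Bool.and_eq_true] at hS; exact hS.2.2.1

/-- `h` is irreducible. [folklore] -/
theorem irreducibleS (hS : fs.checkCoreS = true) : Irreducible (MonicCubic.polyQ fs.a' fs.b' fs.c') := by
  simp only [checkCoreS, Bool.and_eq_true] at hS; exact irreducible_of_noRootMod hS.2.2.2.1

/-- `θ' = dh` is a root of `h`. [folklore] -/
theorem aeval_dh (hθ : aeval θ (MonicCubic.poly fs.base.a fs.base.b fs.base.c) = 0) (hS : fs.checkCoreS = true) :
    aeval (fs.dh.val θ) (MonicCubic.poly fs.a' fs.b' fs.c') = 0 :=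
  FracElt.aeval_val hθ (fs.dhCheck_of_coreS hS)

/-- **The classes of the primes above `q` generate the class group** (split sweep).
[cite: Marcus2018, Ch. 5, Cor. 2 to Thm. 35] [cite: Cohen1993, §6.5] -/
theorem closure_q_eq_top_of_coreS (hθ : aeval θ (MonicCubic.poly fs.base.a fs.base.b fs.base.c) = 0)
    (h3 : finrank ℚ K = 3) (hS : fs.checkCoreS = true) (hpr : fs.base.primeList.Forall Nat.Prime) :
    Subgroup.closure {cc : ClassGroup (𝓞 K) | ∃ (J : Ideal (𝓞 K)) (hJ : J ∈ (Ideal (𝓞 K))⁰),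
      ((fs.base.q : ℕ) : 𝓞 K) ∈ J ∧ ClassGroup.mk0 ⟨J, hJ⟩ = cc} = ⊤ := by
  have hR := fs.checkReg_of_coreS hS
  have hsplit := fs.splitCheck_of_coreS hS
  have hirr := fs.base.irreducible_of_reg hR
  have hirr' := fs.irreducibleS hS
  have hη := fs.aeval_dh hθ hS
  have hq := fs.base.q_prime hpr
  have hS' := hS
  simp only [checkCoreS, checkSweepS, Bool.and_eq_true, decide_eq_true_eq, List.all_eq_true, List.mem_range,
    Bool.or_eq_true, beq_iff_eq, List.any_eq_true] at hS'
  obtain ⟨-, -, -, -, hd, hcov, hcls, hcls2⟩ := hS'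
  refine eq_top_of_classIn_lt_gcd hirr hθ hirr' hη h3 (b := fs.base.bM) hd fun p hpb hp P hP hlt => ?_
  have hpP : (p : 𝓞 K) ∈ P := sweep_natCast_mem p hP
  have hPr : P.IsPrime := hP.1
  rcases hcov p hpb with (((hlt2 | hsf) | rfl) | rfl) | ⟨e, he, hep⟩
  · exact absurd hp.two_le (by omega)
  · rw [ClFieldCert.smallFactor_eq_false hp] at hsf; exact absurd hsf Bool.false_ne_true
  · rcases fs.base.qcover_of_reg hθ h3 hR hpr P hPr hpP with h | h <;> rw [h]
    · exact classIn_tsupp_span_pair_self _ _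
    · exact classIn_tsupp_span_pair_self _ _
  · -- `p = 2`: the split row
    exact SplitTwo.classIn_of_two_mem hirr hθ h3 hsplit hq fs.cls2 hcls2 P hPr hpP
  · subst hep
    have hrow := (fs.base.row_check_of_mem_reg hR he).1
    have hp' := fs.base.prime_of_mem hpr he
    obtain ⟨C, hC, rfl⟩ := cover_of_check hirr hθ h3 hp' hrow P hPr hpP
    rcases hcls e he with hb | hall
    · exfalso
      refine not_pow_inertiaDeg_lt (mem_primesOver_of_check hirr hθ h3 hp' hrow hC)
        (absNorm_of_check hirr hθ h3 hp' hrow hC) ?_ hlt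
      exact hb.trans (Nat.le_self_pow (ClFieldCert.codeDeg_pos C).ne' _)
    · rcases hall C hC with ⟨dd, -, hcc⟩ | ⟨ce, -, hce⟩
      · exact classIn_of_classCheck hirr hθ h3 hp' hrow hC hq hcc hlt
      · exact classIn_of_classCertA hirr hθ h3 hp' hrow hC hq hce.2 hce.1

end ClFieldCertS

end Summit.BirchSwinnertonDyer.BirchSwinnertonDyer.Rank2Observatory.TwoDescCl
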